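import Summits.Parity.GeneralizedHardyLittlewood.Theorems.BeyondDiagonalBeatsQuarter.KernelFormXSqBridge
import Summits.Parity.GeneralizedHardyLittlewood.Theorems.BeyondDiagonalBeatsQuarter.KernelFormXSqTools
import Literature.NumberTheory.LFunctions.MertensElementary
import Literature.NumberTheory.Sieve.PowerfulPartDecomposition
import HarnessLib

/-!
# Summation lemmas for the error terms of the `X²` kernel form: `Σ D(n)²/n`, the dyadic sum, `κ`-weights

Supports stmt-Parity-20343 (`PrimeLevelFamEdge.BeyondDiagonalBeatsQuarter`, K_B; line
`diagonal_kernel_split`, registered stub `stub_kernelFormXSq`). A helper; it closes nothing. Namespace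
`Summit.Parity.GeneralizedHardyLittlewood.Theorems.BeyondDiagonalBeatsQuarter.KernelFormXSq`.

With `D(n) = Σ_{d∣n} d^{−3/4}` (`divWeight`, the arithmetic weight of the core error term
`|S(y;n) − 2E_n| ≪ D(n)/log²(2y)`), the error sums of the kernel form need:

* `sum_divWeight_sq_le` — the mean value `Σ_{n ≤ X} D(n)² ≤ C·X` (expand the square and count
  the `n ≤ X` divisible by `max(d,e)`);
* `sum_divWeight_sq_div_le` — `Σ_{n ≤ N} D(n)²/n ≤ C(1 + log N)` (Abel summation);
* `sum_dyadic_le` / `sum_divWeight_sq_dyadic_le` — **`Σ_{n ≤ M} a(n)/(n(1+log(M/n))²) ≤ 8C`**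
  for `a ≥ 0` with `Σ_{n≤t} a(n) ≤ Ct` (dyadic blocks `M/2^{j+1} < n ≤ M/2^j`);
* `divWeight_prime_mul_le` — `D(pm) ≤ 2D(m)`; `sum_kappa_divWeight_sq_div_le` —
  `Σ_{n ≤ N} κ(n)D(n)²/n ≤ C(1 + log N)` (`κ(n) = Σ_{p∣n} log p/(p−1)`);
* `sum_primes_log_div_succ_le` — `Σ_{p ≤ K} log p/(p+1) ≤ log K + log 4` (tree:
  `MertensElementary.sum_log_div_prime_le`, from Chebyshev).

Everything here is PROVED (theorems only).
«The programme SEARCHES and TYPES; no claim about Landau–Siegel zeros, Theorems 1–2 of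
arXiv:2211.02515 or a repaired Margin232 until a kernel theorem says so.»
-/

noncomputable section

open scoped Real ArithmeticFunction.Moebius ArithmeticFunction.sigma ArithmeticFunction.zeta
open Finset ArithmeticFunction

namespace Summit.Parity.GeneralizedHardyLittlewood.Theorems.BeyondDiagonalBeatsQuarter.KernelFormXSq

open Literature.NumberTheory.LFunctions Literature.NumberTheory.LFunctions.KMV2000
open Literature.NumberTheory.Sieve.PowerfulPart (sum_Icc_one_div_mul_sqrt_le)
open SelbergCoord (kappa)
open Literature.Barriers.Parity (Icc_one_eq_Ioc_zero)

/-! ### The mean value of `D(n)²` -/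

/-- `#{n ≤ X : d ∣ n} = X/d ≤ X/d` as a real bound: `Σ_{n ≤ X, d∣n} 1 ≤ X/d`. [folklore] -/
theorem card_multiples_le {d : ℕ} (hd : d ≠ 0) (X : ℕ) :
    (((Icc 1 X).filter (fun n ↦ d ∣ n)).card : ℝ) ≤ (X : ℝ) / d := by
  have h : (Icc 1 X).filter (fun n ↦ d ∣ n) = (Icc 1 (X / d)).image (fun j ↦ d * j) := by
    ext n
    simp only [Finset.mem_filter, Finset.mem_Icc, Finset.mem_image]
    constructor
    · rintro ⟨⟨hn1, hnX⟩, ⟨j, rfl⟩⟩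
      refine ⟨j, ⟨?_, ?_⟩, rfl⟩
      · rcases Nat.eq_zero_or_pos j with rfl | hj
        · omega
        · exact hj
      · exact (Nat.le_div_iff_mul_le (Nat.pos_of_ne_zero hd)).2 (by rwa [mul_comm] at hnX)
    · rintro ⟨j, ⟨hj1, hjX⟩, rfl⟩
      refine ⟨⟨Nat.one_le_iff_ne_zero.2 (mul_ne_zero hd (by omega)), ?_⟩, dvd_mul_right d j⟩
      have := (Nat.le_div_iff_mul_le (Nat.pos_of_ne_zero hd)).1 hjX
      rwa [mul_comm] at this
  rw [h, Finset.card_image_of_injective _ fun j k hjk ↦ (Nat.mul_right_inj hd).1 hjk,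
    Nat.card_Icc, Nat.add_sub_cancel]
  have hd0 : (0 : ℝ) < d := by exact_mod_cast Nat.pos_of_ne_zero hd
  rw [le_div_iff₀ hd0]
  exact_mod_cast Nat.div_mul_le_self X d

/-- **The mean value of `D²`**: `Σ_{n ≤ X} D(n)² ≤ Z₂·X` with `Z₂ = (Σ_{d ≥ 1} d^{−5/4})²`
(`D(n)² = Σ_{d,e∣n}(de)^{−3/4}`, `#{n ≤ X : d,e∣n} ≤ X/max(d,e) ≤ X(de)^{−1/2}`). [folklore] -/
theorem sum_divWeight_sq_le (X : ℕ) :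
    ∑ n ∈ Icc 1 X, divWeight n ^ 2 ≤ (∑' d : ℕ, (d : ℝ) ^ (-(5 / 4 : ℝ))) ^ 2 * X := by
  have hsum : Summable fun d : ℕ ↦ (d : ℝ) ^ (-(5 / 4 : ℝ)) := Real.summable_nat_rpow.2 (by norm_num)
  set Z : ℝ := ∑' d : ℕ, (d : ℝ) ^ (-(5 / 4 : ℝ)) with hZ
  have hZ0 : 0 ≤ Z := tsum_nonneg fun d ↦ by positivity
  have hfin : ∑ d ∈ Icc 1 X, (d : ℝ) ^ (-(5 / 4 : ℝ)) ≤ Z := hsum.sum_le_tsum _ fun d _ ↦ by positivity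
  set f : ℕ → ℝ := fun d ↦ (d : ℝ) ^ (-(3 / 4 : ℝ)) with hf
  -- expand the square and exchange
  have h1 : ∀ n ∈ Icc 1 X, divWeight n ^ 2 =
      ∑ d ∈ Icc 1 X, ∑ e ∈ Icc 1 X, if d ∣ n ∧ e ∣ n then f d * f e else 0 := by
    intro n hn
    have hn' := Finset.mem_Icc.1 hn
    have hn0 : n ≠ 0 := by omega
    have hdiv : ∀ g : ℕ → ℝ, ∑ d ∈ n.divisors, g d = ∑ d ∈ Icc 1 X, if d ∣ n then g d else 0 := by
      intro g
      rw [← Finset.sum_filter]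
      congr 1
      ext d
      simp only [Nat.mem_divisors, Finset.mem_filter, Finset.mem_Icc]
      constructor
      · rintro ⟨hdn, -⟩
        exact ⟨⟨Nat.pos_of_dvd_of_pos hdn (by omega), (Nat.le_of_dvd (by omega) hdn).trans hn'.2⟩, hdn⟩
      · rintro ⟨-, hdn⟩; exact ⟨hdn, hn0⟩
    rw [divWeight, sq, hdiv, Finset.sum_mul]
    refine Finset.sum_congr rfl fun d _ ↦ ?_
    by_cases hdn : d ∣ n
    · rw [if_pos hdn, Finset.mul_sum]
      refine Finset.sum_congr rfl fun e _ ↦ ?_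
      by_cases hen : e ∣ n
      · rw [if_pos hen, if_pos ⟨hdn, hen⟩]
      · rw [if_neg hen, if_neg (fun h ↦ hen h.2), mul_zero]
    · rw [if_neg hdn, zero_mul]
      refine (Finset.sum_eq_zero fun e _ ↦ ?_).symm
      rw [if_neg (fun h ↦ hdn h.1)]
  rw [Finset.sum_congr rfl h1, Finset.sum_comm]
  -- for each `d`: exchange again and count
  have h2 : ∀ d ∈ Icc 1 X, ∑ n ∈ Icc 1 X, ∑ e ∈ Icc 1 X, (if d ∣ n ∧ e ∣ n then f d * f e else 0) ≤
      (d : ℝ) ^ (-(5 / 4 : ℝ)) * (∑ e ∈ Icc 1 X, (e : ℝ) ^ (-(5 / 4 : ℝ))) * X := by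
    intro d hd
    have hd1 : 1 ≤ d := (Finset.mem_Icc.1 hd).1
    have hd0 : (0 : ℝ) < d := by exact_mod_cast hd1
    rw [Finset.sum_comm, Finset.mul_sum, Finset.sum_mul]
    refine Finset.sum_le_sum fun e he ↦ ?_
    have he1 : 1 ≤ e := (Finset.mem_Icc.1 he).1
    have he0 : (0 : ℝ) < e := by exact_mod_cast he1
    -- `Σ_n [d|n][e|n] f d f e ≤ f d f e · #{n : max d e ∣ n} ≤ f d f e · X / max d e`
    have hle : ∑ n ∈ Icc 1 X, (if d ∣ n ∧ e ∣ n then f d * f e else 0) ≤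
        f d * f e * ((X : ℝ) / max d e) := by
      rw [← Finset.sum_filter]
      have hsub : (Icc 1 X).filter (fun n ↦ d ∣ n ∧ e ∣ n) ⊆ (Icc 1 X).filter (fun n ↦ max d e ∣ n) := by
        intro n hn
        simp only [Finset.mem_filter] at hn ⊢
        refine ⟨hn.1, ?_⟩
        rcases le_total d e with h | h
        · rw [max_eq_right h]; exact hn.2.2
        · rw [max_eq_left h]; exact hn.2.1
      calc ∑ n ∈ (Icc 1 X).filter (fun n ↦ d ∣ n ∧ e ∣ n), f d * f e
          ≤ ∑ n ∈ (Icc 1 X).filter (fun n ↦ max d e ∣ n), f d * f e :=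
            Finset.sum_le_sum_of_subset_of_nonneg hsub fun n _ _ ↦ by positivity
        _ = f d * f e * (((Icc 1 X).filter (fun n ↦ max d e ∣ n)).card : ℝ) := by
            rw [Finset.sum_const, nsmul_eq_mul, mul_comm]
        _ ≤ f d * f e * ((X : ℝ) / max d e) :=
            mul_le_mul_of_nonneg_left (card_multiples_le (by positivity) X) (by positivity)
    refine hle.trans ?_
    -- `f d f e / max d e ≤ (de)^{-5/4}` since `max d e ≥ √(de)`
    have hmax : Real.sqrt ((d : ℝ) * e) ≤ ((max d e : ℕ) : ℝ) := by
      rw [Real.sqrt_le_left (by positivity)]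
      push_cast
      rcases le_total d e with h | h
      · rw [max_eq_right (by exact_mod_cast h : (d : ℝ) ≤ e), sq]
        exact mul_le_mul_of_nonneg_right (by exact_mod_cast h) he0.le
      · rw [max_eq_left (by exact_mod_cast h : (e : ℝ) ≤ d), sq]
        exact mul_le_mul_of_nonneg_left (by exact_mod_cast h) hd0.le
    have hsq : Real.sqrt ((d : ℝ) * e) = (d : ℝ) ^ (1 / 2 : ℝ) * (e : ℝ) ^ (1 / 2 : ℝ) := by
      rw [Real.sqrt_eq_rpow, Real.mul_rpow hd0.le he0.le]
    have hmax0 : 0 < ((max d e : ℕ) : ℝ) := by positivity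
    calc f d * f e * ((X : ℝ) / max d e) = f d * f e / ((max d e : ℕ) : ℝ) * X := by
          push_cast; ring
      _ ≤ f d * f e / Real.sqrt ((d : ℝ) * e) * X := by
          refine mul_le_mul_of_nonneg_right ?_ (Nat.cast_nonneg X)
          exact div_le_div_of_nonneg_left (by positivity) (by positivity) hmax
      _ = (d : ℝ) ^ (-(5 / 4 : ℝ)) * (e : ℝ) ^ (-(5 / 4 : ℝ)) * X := by
          rw [hsq, hf]
          dsimp only
          rw [show (-(5 / 4 : ℝ)) = -(3 / 4 : ℝ) - 1 / 2 by norm_num, Real.rpow_sub hd0,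
            Real.rpow_sub he0]
          field_simp
  refine (Finset.sum_le_sum h2).trans ?_
  rw [← Finset.sum_mul, ← Finset.sum_mul, ← sq]
  refine mul_le_mul_of_nonneg_right ?_ (Nat.cast_nonneg X)
  exact pow_le_pow_left₀ (Finset.sum_nonneg fun d _ ↦ by positivity) hfin 2


/-! ### `Σ a(n)/n` and the dyadic sum from a linear bound on partial sums -/

/-- Abel: if `a ≥ 0` and `Σ_{n ≤ t} a(n) ≤ C t` for all `t`, then `Σ_{n ≤ N} a(n)/n ≤ C(2 + log N)`
(`N ≥ 1`). [folklore] -/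
theorem sum_div_le_of_linear {a : ℕ → ℝ} {C : ℝ} (ha : ∀ n, 0 ≤ a n)
    (hA : ∀ t : ℕ, ∑ n ∈ Icc 1 t, a n ≤ C * t) {N : ℕ} (hN : 1 ≤ N) :
    ∑ n ∈ Icc 1 N, a n / n ≤ C * (2 + Real.log N) := by
  have hC : 0 ≤ C := by
    have h := hA 1
    simp only [Finset.Icc_self, Finset.sum_singleton, Nat.cast_one, mul_one] at h
    exact (ha 1).trans h
  rw [Icc_one_eq_Ioc_zero]
  have hre : ∑ e ∈ Ioc 0 N, a e / e = ∑ e ∈ Ioc 0 N, a e * ((e : ℝ))⁻¹ :=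
    Finset.sum_congr rfl fun e _ ↦ div_eq_mul_inv _ _
  rw [hre, sum_Ioc_mul_eq_abel a (fun n ↦ ((n : ℝ))⁻¹) (Nat.zero_le N)]
  -- interior terms: `A(e)(1/e − 1/(e+1)) ≤ C/(e+1) ≤ C/e`
  have h1 : ∑ e ∈ Ioc 0 N, (∑ k ∈ Icc 1 e, a k) * (((e : ℝ))⁻¹ - (((e + 1 : ℕ) : ℝ))⁻¹) ≤
      ∑ e ∈ Ioc 0 N, C * ((e : ℝ))⁻¹ := by
    refine Finset.sum_le_sum fun e he ↦ ?_
    have he0 : (0 : ℝ) < e := by exact_mod_cast (Finset.mem_Ioc.1 he).1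
    have hdiff : ((e : ℝ))⁻¹ - (((e + 1 : ℕ) : ℝ))⁻¹ = 1 / ((e : ℝ) * (e + 1)) := by
      push_cast; field_simp; ring
    rw [hdiff]
    calc (∑ k ∈ Icc 1 e, a k) * (1 / ((e : ℝ) * (e + 1))) ≤ C * e * (1 / ((e : ℝ) * (e + 1))) :=
          mul_le_mul_of_nonneg_right (hA e) (by positivity)
      _ = C * (1 / ((e : ℝ) + 1)) := by field_simp
      _ ≤ C * ((e : ℝ))⁻¹ := by
          refine mul_le_mul_of_nonneg_left ?_ hC
          rw [one_div]; exact inv_anti₀ he0 (by linarith)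
  have h2 : (∑ k ∈ Icc 1 N, a k) * (((N + 1 : ℕ) : ℝ))⁻¹ ≤ C := by
    have hN0 : (0 : ℝ) < ((N + 1 : ℕ) : ℝ) := by positivity
    rw [← div_eq_mul_inv, div_le_iff₀ hN0]
    refine (hA N).trans ?_
    push_cast; nlinarith
  have hharm : ∑ e ∈ Ioc 0 N, ((e : ℝ))⁻¹ ≤ 1 + Real.log N := by
    rw [← Icc_one_eq_Ioc_zero]
    have h := harmonic_le_one_add_log N
    simpa [harmonic_eq_sum_Icc, Rat.cast_sum, Rat.cast_inv, Rat.cast_natCast] using h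
  have hsumZero : (∑ k ∈ Icc 1 0, a k) = 0 := by simp
  rw [hsumZero, zero_mul, sub_zero]
  have h3 : ∑ e ∈ Ioc 0 N, C * ((e : ℝ))⁻¹ ≤ C * (1 + Real.log N) := by
    rw [← Finset.mul_sum]; exact mul_le_mul_of_nonneg_left hharm hC
  linarith [h1, h2, h3]

/-- **`Σ_{n ≤ N} D(n)²/n ≤ Z₂(2 + log N)`** (`N ≥ 1`). [folklore] -/
theorem sum_divWeight_sq_div_le {N : ℕ} (hN : 1 ≤ N) :
    ∑ n ∈ Icc 1 N, divWeight n ^ 2 / n ≤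
      (∑' d : ℕ, (d : ℝ) ^ (-(5 / 4 : ℝ))) ^ 2 * (2 + Real.log N) :=
  sum_div_le_of_linear (fun _ ↦ sq_nonneg _) sum_divWeight_sq_le hN

/-- `Σ_{j < J} 4/(j+2)² ≤ 4` (telescoping against `1/((j+1)(j+2))`). [folklore] -/
theorem sum_four_div_sq_le (J : ℕ) : ∑ j ∈ Finset.range J, (4 : ℝ) / ((j : ℝ) + 2) ^ 2 ≤ 4 := by
  have h : ∀ J : ℕ, ∑ j ∈ Finset.range J, (4 : ℝ) / ((j : ℝ) + 2) ^ 2 ≤ 4 - 4 / ((J : ℝ) + 1) := by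
    intro J
    induction J with
    | zero => simp
    | succ J ih =>
      rw [Finset.sum_range_succ]
      have hJ : (0 : ℝ) < (J : ℝ) + 1 := by positivity
      have hstep : (4 : ℝ) / ((J : ℝ) + 2) ^ 2 ≤ 4 / ((J : ℝ) + 1) - 4 / (((J + 1 : ℕ) : ℝ) + 1) := by
        push_cast
        rw [show (J : ℝ) + 1 + 1 = J + 2 by ring, div_sub_div _ _ hJ.ne' (by positivity),
          div_le_div_iff₀ (by positivity) (by positivity)]
        nlinarith
      push_cast at hstep ⊢
      linarith
  exact (h J).trans (sub_le_self _ (by positivity))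

/-- **The dyadic summation lemma.** If `a ≥ 0` and `Σ_{n ≤ t} a(n) ≤ Ct` for all `t`, then for
`M ≥ 1`: `Σ_{n ≤ M} a(n)/(n(1 + log(M/n))²) ≤ 8C` (on the block `M/2^{j+1} < n ≤ M/2^j` the weight is
`≤ 2^{j+1}/(M(1 + j log 2)²)` and the block mass is `≤ CM/2^j`). [folklore] -/
theorem sum_dyadic_le {a : ℕ → ℝ} {C : ℝ} (ha : ∀ n, 0 ≤ a n)
    (hA : ∀ t : ℕ, ∑ n ∈ Icc 1 t, a n ≤ C * t) {M : ℝ} (hM : 1 ≤ M) :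
    ∑ n ∈ Icc 1 ⌊M⌋₊, a n / (n * (1 + Real.log (M / n)) ^ 2) ≤ 8 * C := by
  have hC : 0 ≤ C := by
    have h := hA 1
    simp only [Finset.Icc_self, Finset.sum_singleton, Nat.cast_one, mul_one] at h
    exact (ha 1).trans h
  set N : ℕ := ⌊M⌋₊ with hNdef
  have hM0 : 0 < M := by linarith
  have hN1 : 1 ≤ N := Nat.le_floor (by simpa using hM)
  have hNM : (N : ℝ) ≤ M := Nat.floor_le hM0.le
  have hN0 : (0 : ℝ) < N := by exact_mod_cast hN1
  -- the block index `j(n) = log₂ ⌊N/n⌋`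
  set J : ℕ := Nat.log 2 N with hJ
  set blk : ℕ → ℕ := fun n ↦ Nat.log 2 (N / n) with hblk
  have hmaps : ∀ n ∈ Icc 1 N, blk n ∈ Finset.range (J + 1) := by
    intro n hn
    rw [Finset.mem_range, Nat.lt_succ_iff, hblk, hJ]
    exact Nat.log_mono_right (Nat.div_le_self N n)
  rw [← Finset.sum_fiberwise_of_maps_to hmaps]
  -- the bound on one block
  have hblock : ∀ j ∈ Finset.range (J + 1),
      ∑ n ∈ (Icc 1 N).filter (fun n ↦ blk n = j), a n / (n * (1 + Real.log (M / n)) ^ 2) ≤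
        2 * C * (4 / ((j : ℝ) + 2) ^ 2) := by
    intro j _
    have hl2 : (1 : ℝ) / 2 ≤ Real.log 2 := by
      have := Real.log_two_gt_d9; linarith
    have hpow0 : (0 : ℝ) < (2 : ℝ) ^ j := by positivity
    -- weight bound on the block
    have hw : ∀ n ∈ (Icc 1 N).filter (fun n ↦ blk n = j),
        a n / (n * (1 + Real.log (M / n)) ^ 2) ≤ a n * ((2 : ℝ) ^ (j + 1) / N * (4 / ((j : ℝ) + 2) ^ 2)) := by
      intro n hn
      rw [Finset.mem_filter] at hn
      obtain ⟨hn', hj⟩ := hn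
      have hn1 : 1 ≤ n := (Finset.mem_Icc.1 hn').1
      have hn0 : (0 : ℝ) < n := by exact_mod_cast hn1
      have hnN : n ≤ N := (Finset.mem_Icc.1 hn').2
      -- `2^j ≤ N/n < 2^{j+1}`
      have hq0 : N / n ≠ 0 := (Nat.div_pos hnN (by omega)).ne'
      have hlow : 2 ^ j ≤ N / n := by rw [← hj]; exact Nat.pow_log_le_self 2 hq0
      have hup : N / n < 2 ^ (j + 1) := by rw [← hj]; exact Nat.lt_pow_succ_log_self (by norm_num) _
      have hlow' : (2 : ℝ) ^ j * n ≤ N := by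
        have := (Nat.le_div_iff_mul_le (by omega)).1 hlow
        exact_mod_cast this
      have hup' : (N : ℝ) < (2 : ℝ) ^ (j + 1) * n := by
        have := (Nat.div_lt_iff_lt_mul (by omega)).1 hup
        exact_mod_cast this
      -- the weight
      have hinv : ((n : ℝ))⁻¹ ≤ (2 : ℝ) ^ (j + 1) / N := by
        rw [inv_eq_one_div, div_le_div_iff₀ hn0 hN0]; linarith
      have hlog : ((j : ℝ) + 2) / 2 ≤ 1 + Real.log (M / n) := by
        have h1 : Real.log ((2 : ℝ) ^ j) ≤ Real.log (M / n) := by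
          apply Real.log_le_log hpow0
          rw [le_div_iff₀ hn0]; linarith
        rw [Real.log_pow] at h1
        nlinarith
      have hlog0 : 0 < 1 + Real.log (M / n) := by
        have : (0 : ℝ) < ((j : ℝ) + 2) / 2 := by positivity
        linarith
      have hwt : 1 / (1 + Real.log (M / n)) ^ 2 ≤ 4 / ((j : ℝ) + 2) ^ 2 := by
        rw [div_le_div_iff₀ (by positivity) (by positivity)]
        have : ((j : ℝ) + 2) ^ 2 ≤ (2 * (1 + Real.log (M / n))) ^ 2 :=
          pow_le_pow_left₀ (by positivity) (by linarith) 2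
        nlinarith
      calc a n / (n * (1 + Real.log (M / n)) ^ 2) = a n * (((n : ℝ))⁻¹ * (1 / (1 + Real.log (M / n)) ^ 2)) := by
            field_simp
        _ ≤ a n * ((2 : ℝ) ^ (j + 1) / N * (4 / ((j : ℝ) + 2) ^ 2)) :=
            mul_le_mul_of_nonneg_left (mul_le_mul hinv hwt (by positivity) (by positivity)) (ha n)
    -- the block is contained in `[1, N/2^j]`
    have hsub : (Icc 1 N).filter (fun n ↦ blk n = j) ⊆ Icc 1 (N / 2 ^ j) := by
      intro n hn
      rw [Finset.mem_filter] at hn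
      obtain ⟨hn', hj'⟩ := hn
      have hn1 : 1 ≤ n := (Finset.mem_Icc.1 hn').1
      have hnN : n ≤ N := (Finset.mem_Icc.1 hn').2
      have hq0 : N / n ≠ 0 := (Nat.div_pos hnN (by omega)).ne'
      have hlow : 2 ^ j ≤ N / n := by rw [← hj']; exact Nat.pow_log_le_self 2 hq0
      rw [Finset.mem_Icc]
      refine ⟨hn1, (Nat.le_div_iff_mul_le (by positivity)).2 ?_⟩
      have := (Nat.le_div_iff_mul_le (by omega)).1 hlow
      rwa [mul_comm] at this
    calc ∑ n ∈ (Icc 1 N).filter (fun n ↦ blk n = j), a n / (n * (1 + Real.log (M / n)) ^ 2)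
        ≤ ∑ n ∈ (Icc 1 N).filter (fun n ↦ blk n = j), a n * ((2 : ℝ) ^ (j + 1) / N * (4 / ((j : ℝ) + 2) ^ 2)) :=
          Finset.sum_le_sum hw
      _ = (∑ n ∈ (Icc 1 N).filter (fun n ↦ blk n = j), a n) * ((2 : ℝ) ^ (j + 1) / N * (4 / ((j : ℝ) + 2) ^ 2)) := by
          rw [Finset.sum_mul]
      _ ≤ (∑ n ∈ Icc 1 (N / 2 ^ j), a n) * ((2 : ℝ) ^ (j + 1) / N * (4 / ((j : ℝ) + 2) ^ 2)) :=
          mul_le_mul_of_nonneg_right (Finset.sum_le_sum_of_subset_of_nonneg hsub fun n _ _ ↦ ha n)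
            (by positivity)
      _ ≤ (C * ((N / 2 ^ j : ℕ) : ℝ)) * ((2 : ℝ) ^ (j + 1) / N * (4 / ((j : ℝ) + 2) ^ 2)) :=
          mul_le_mul_of_nonneg_right (hA _) (by positivity)
      _ ≤ (C * ((N : ℝ) / (2 : ℝ) ^ j)) * ((2 : ℝ) ^ (j + 1) / N * (4 / ((j : ℝ) + 2) ^ 2)) := by
          gcongr
          have h : (((N / 2 ^ j : ℕ) : ℝ)) ≤ (N : ℝ) / ((2 ^ j : ℕ) : ℝ) := Nat.cast_div_le
          push_cast at h
          exact h
      _ = 2 * C * (4 / ((j : ℝ) + 2) ^ 2) := by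
          field_simp
          ring
  refine (Finset.sum_le_sum hblock).trans ?_
  rw [← Finset.mul_sum]
  calc 2 * C * ∑ j ∈ Finset.range (J + 1), 4 / ((j : ℝ) + 2) ^ 2 ≤ 2 * C * 4 :=
        mul_le_mul_of_nonneg_left (sum_four_div_sq_le _) (by positivity)
    _ = 8 * C := by ring

/-- **The dyadic sum of `D²`**: `Σ_{n ≤ M} D(n)²/(n(1 + log(M/n))²) ≤ 8Z₂` for `M ≥ 1`. [folklore] -/
theorem sum_divWeight_sq_dyadic_le {M : ℝ} (hM : 1 ≤ M) :
    ∑ n ∈ Icc 1 ⌊M⌋₊, divWeight n ^ 2 / (n * (1 + Real.log (M / n)) ^ 2) ≤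
      8 * (∑' d : ℕ, (d : ℝ) ^ (-(5 / 4 : ℝ))) ^ 2 := by
  have h := sum_dyadic_le (fun n ↦ sq_nonneg (divWeight n)) sum_divWeight_sq_le hM
  linarith

end Summit.Parity.GeneralizedHardyLittlewood.Theorems.BeyondDiagonalBeatsQuarter.KernelFormXSq
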